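import Summits.AnomalousDissipation.AnomalousDissipation.Theorems.CoherentFractionInvariantExtremeClimatesPlanar.Negative.OrbitExtreme
import Summits.AnomalousDissipation.AnomalousDissipation.Theses.CoherentFraction
import HarnessLib

/-!
# `InvariantExtremeClimatesPlanar` (stmt-AnomalousDissipation-28074, route CoherentFraction, support r9) is FALSE

The item asks: for every drift `m`, every enstrophy ceiling `R` and every EXTREME point `μ` of the
climate class `𝒞̄(m,R)` — probability measures on the energy space with a.e. enstrophy `≤ R` that are
stationary for the Euler generator with drift `m + h` against all cylindrical functionals, for EVERY
horizontal `h ⊥ e₁` — if `μ` is not carried by the states of some finite Fourier type then `μ`-a.e.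
state is planar (translation-invariant in some horizontal lattice direction).

WITNESS (blocks A–C2 on the negative lane `…/CoherentFractionInvariantExtremeClimatesPlanar/Negative/`):
the ORBIT CLIMATE `μ = orb_* Haar(𝕋²)` of the crossed-shear / reciprocal-shear root `v`
(`v = (c4(x₁)/ρ(x₂)) e₀ + ((c4(x₀) + c_K) ρ(x₂) − c_K) e₁`, `c4 = cos 4π·`, `1/ρ = 1 + ½ cos 2π·`,
`c_K = −1/(4π)`), `orb σ = v(· + (σ₀, 0, σ₁))`, with `m = c_K e₁` and `R = R₀ = ‖∇v‖²`:
* `μ ∈ 𝒞̄(c_K e₁, R₀)` (`orbMeasure_mem_climateClass`, block B): every orbit state is a smooth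
  steady Euler+drift root with the same enstrophy, and the extra drift pairing `(w, (h·∇)Φ'(w))`
  integrates to zero over the orbit because it is a derivative along the horizontal flow
  `σ ↦ σ + t h̄` of the Haar measure;
* `μ` is EXTREME in `𝒞̄(c_K e₁, R₀)` (`orbMeasure_mem_extremePoints`, block C2): a convex component
  `ρ ≪ μ` has a pulled-back density `R` on `𝕋²` whose nonzero Fourier coefficients all vanish —
  the even-first-index ones by testing the stationarity of `ρ` against the probe functionals
  `Φ_{j,l,w}` of block C1 (their value on the orbit is the character `Re(w Γ e_{(2j,l)})`), the
  odd ones by the half-period symmetry `orb(σ + (½,0)) = orb σ` — so `R = 1` a.e. and `ρ = μ`;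
* `μ` is not of finite type (`not_finiteType`, block A: every orbit state has the modes
  `(0, ±2, n)`, `n ∈ ℤ`, all nonzero);
* `μ`-a.e. planarity fails (`not_ae_defect_zero`, block A: the translation defect of every orbit
  state is `≥ c_K²/16 > 0` in every horizontal lattice direction).

Class: refuted-SUBSTANTIVE.  The load-bearing claim «extremality + infinite type ⇒ planar support»
is false: the non-planar steady roots come in a `𝕋²`-orbit whose Haar climate is an ergodic
(= extreme) invariant climate of infinite type.  NO CHEAP REPAIR: (i) «finite Fourier type» repairs
are the separate items `FiniteModeRootsPlanar` 27870 / `FiniteTypeClimatesPlanar` 28073 (untouched);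
(ii) excluding Dirac climates (the repair that separates this item from 27871) is already built in
and is defeated by the orbit climate; (iii) demanding invariance under the full horizontal
translation group instead of stationarity for all horizontal drifts changes nothing — `μ` IS
translation-invariant; (iv) small-enstrophy / laminar-proximity side conditions fail on the same
one-parameter family `ε → 0` of roots (census E31/E28b of record).  Barrier-candidate:
«reciprocal-shear modulation» (already of record, `ledger negatives --problem AnomalousDissipation`).
-/

noncomputable section

-- `Summit.<Summit>.<Problem>` is the tree's mandated summit-side namespace (CONVENTIONS §2); for this
-- single-conjunct summit the two segments coincide, so the duplicate is deliberate.
set_option linter.dupNamespace false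

namespace Summit.AnomalousDissipation.AnomalousDissipation.Theorems.CrossedShearOrbit

/-- **KILL: `InvariantExtremeClimatesPlanar` (stmt-AnomalousDissipation-28074) is FALSE.**
Refutes `CoherentFraction.InvariantExtremeClimatesPlanar` [refuted-substantive]: «every extreme point of
the horizontally-invariant tame stationary Euler+drift climate class that is not of finite Fourier type
is carried by planar states».  Witness: `m := c_K e₁`, `R := R₀ = ‖∇v‖²`, `μ := orbMeasure = orb_* Haar(𝕋²)`,
the orbit climate of the crossed-shear root `v`; `μ ∈ extremePoints ℝ≥0∞ 𝒞̄(m,R)`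
(`orbMeasure_mem_extremePoints`), `μ` is not of finite type (`not_finiteType`), and the planarity
conclusion fails `μ`-a.e. (`not_ae_defect_zero`).  No cheap repair: finite-type repairs are items
27870/28073; Dirac exclusion and full horizontal invariance are already satisfied by the witness;
small-data side conditions fail along the root family `ε → 0`.  barrier-candidate: reciprocal-shear
modulation (of record). [folklore] -/
theorem CoherentFractionInvariantExtremeClimatesPlanar_refuted :
    ¬ Summit.AnomalousDissipation.AnomalousDissipation.Theses.CoherentFraction.InvariantExtremeClimatesPlanar :=
  fun h => not_ae_defect_zero
    (h Summit.AnomalousDissipation.AnomalousDissipation.Theorems.CrossedShearRoot.drift R0 orbMeasure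
      orbMeasure_mem_extremePoints not_finiteType)

end Summit.AnomalousDissipation.AnomalousDissipation.Theorems.CrossedShearOrbit

end
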